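import Literature.NumberTheory.LFunctions.CentralValueFamilyToZeroFreeRegion
import Literature.NumberTheory.LFunctions.IwaniecSarnakFamilyWeightTwoPB
import Literature.NumberTheory.LFunctions.IwaniecSarnakFamilyAmplifiedEvenSharePB
import HarnessLib

/-!
# From the ½-proportion edge to `L(1,χ) ≫ (log D)⁻⁴` and a zero-free region — RE-THREADED to the
# printed range of the Petersson bound (`kowalskiMichel2000_peterssonBound`, R2-G44)

Topic `Literature/NumberTheory/LFunctions` (namespace
`Literature.NumberTheory.LFunctions.CentralValueFamilyHalfEdge`). GLUE and PROOFS, zero named facts.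
Companion («`_pb` twins») of `CentralValueFamilyToZeroFreeRegion.lean`: its three chains that carry the
binder `(hP : KowalskiMichel2000.kowalskiMichel2000_petersson)` — FALSE AS TYPED at `(m,n) = (q,q)`
(`KowalskiMichel2000.not_kowalskiMichel2000_petersson`, cell record R2-G44; «refuted-as-typed ≠
refuted-in-print») — are re-stated verbatim over the fact in its printed range,
`KowalskiMichel2000.kowalskiMichel2000_peterssonBound` (binder `¬ (q ∣ m ∧ q ∣ n)`, KM2000 §2.3 p. 310
display after (16) with §2.4.2 (23)), composing the re-threaded inputs
`lOne_lowerBound_of_untwistedProportion_weightTwo_withLemma1_pb` (`IwaniecSarnakFamilyWeightTwoPB`, p531806) and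
`lOne_lowerBound_ampPrimeFamilyTwo_total_pb` (`IwaniecSarnakFamilyAmplifiedEvenSharePB`). Old decls
untouched; no use of the negated fact (smuggling rule).
«The programme SEARCHES and TYPES; no claim about Landau–Siegel zeros, Theorems 1–2 of arXiv:2211.02515
or a repaired Margin232 until a kernel theorem says so.»

## References

* [IwaniecConversations2006] §7 (7.7) and p. 97.
* [KowalskiMichel2000] §2.3 display after (16) IN ITS RANGE (§2.4.2 (23)); Lemma 1.
-/

noncomputable section

namespace Literature.NumberTheory.LFunctions.CentralValueFamilyHalfEdge

open scoped MatrixGroups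
open Finset Real CongruenceSubgroup
open Literature.NumberTheory.LFunctions.Zhang2022
open Literature.NumberTheory.LFunctions.IwaniecSarnak

/-- **E*-fam(η) at weight 2 + the typed printed facts (Petersson IN ITS RANGE) ⇒ `L(1,χ_D) >
c₁(log D)⁻⁴` for every real primitive `χ_D`, `D ≥ 3`** (`Skeleton.LOneLowerBound 4`) — re-thread of
`lOneLowerBound_four_of_untwistedProportion_weightTwo` (R2-G44). [cite: IwaniecConversations2006, §7 (7.7) and p. 97] -/
theorem lOneLowerBound_four_of_untwistedProportion_weightTwo_pb {η : ℝ} (hη : 0 < η)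
    (hLR : lapidRallis2003_theorem1_gl2Twist) (hTw : iwaniec2006_twistedHalf)
    (hMix : iwaniec2006_mixedMomentOverMass)
    (hP : KowalskiMichel2000.kowalskiMichel2000_peterssonBound)
    (hL : KowalskiMichel2000.kowalskiMichel2000_lemma1)
    (hUn : UntwistedProportion 2 (1 / 2 + η)) :
    Skeleton.LOneLowerBound 4 := by
  refine lOneLowerBound_of_eventual ?_
  obtain ⟨c, hc, D₀, h⟩ :=
    lOne_lowerBound_of_untwistedProportion_weightTwo_withLemma1_pb hη hLR hTw hMix hP hL hUn
  exact ⟨c, hc, D₀, fun D _ χ hD hprim hquad => h D χ hD hprim hquad⟩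

/-- **E*-fam(η) at weight 2 + the typed printed facts (Petersson IN ITS RANGE) ⇒ the zero-free region
`σ > 1 − c₂(log D)⁻⁶`** (`Skeleton.ZeroFreeRegion 6`; caveat as in the original: strictly weaker than
`NoSiegelZeros`) — re-thread of `zeroFreeRegion_six_of_untwistedProportion_weightTwo` (R2-G44).
[cite: IwaniecConversations2006, §7 (7.7) and p. 97] -/
theorem zeroFreeRegion_six_of_untwistedProportion_weightTwo_pb {η : ℝ} (hη : 0 < η)
    (hLR : lapidRallis2003_theorem1_gl2Twist) (hTw : iwaniec2006_twistedHalf)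
    (hMix : iwaniec2006_mixedMomentOverMass)
    (hP : KowalskiMichel2000.kowalskiMichel2000_peterssonBound)
    (hL : KowalskiMichel2000.kowalskiMichel2000_lemma1)
    (hUn : UntwistedProportion 2 (1 / 2 + η)) :
    Skeleton.ZeroFreeRegion 6 :=
  Skeleton.zeroFreeRegion_of_lOneLowerBound 4
    (lOneLowerBound_four_of_untwistedProportion_weightTwo_pb hη hLR hTw hMix hP hL hUn)

/-- **The amplified edge at prime level, weight 2, in the summit vocabulary, from the Petersson facts IN
THEIR RANGE** — re-thread of `lOneLowerBound_four_of_ampPrimeFamilyTwo_total` (R2-G44) via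
`lOne_lowerBound_ampPrimeFamilyTwo_total_pb`. [cite: IwaniecConversations2006, §7 (7.7)] -/
theorem lOneLowerBound_four_of_ampPrimeFamilyTwo_total_pb {S : ℕ+ → Finset ℕ} {c : ℕ+ → ℕ → ℝ}
    (hLR : lapidRallis2003_theorem1_gl2Twist)
    (hP : KowalskiMichel2000.kowalskiMichel2000_peterssonBound)
    (hL : KowalskiMichel2000.kowalskiMichel2000_lemma1) (hS : SublinearCubes S)
    (hc : ∀ N : ℕ+, 0 < ∑ l ∈ S N, c N l ^ 2) {p₁ p₂ δ : ℝ} (hδ : 0 < δ)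
    (htot : (iwaniecSarnakFamilyAmp 2 (linAmp S c)).MixedOverTotalMass δ)
    (htw : (iwaniecSarnakFamilyAmp 2 (linAmp S c)).TwistedHalf p₂ 2 δ)
    (hE : (ampPrimeFamilyTwo S c).EStarFam p₁ 2) (hp : 1 < p₁ + p₂) :
    Skeleton.LOneLowerBound 4 := by
  refine lOneLowerBound_of_eventual ?_
  obtain ⟨c₀, hc₀, D₀, h⟩ :=
    lOne_lowerBound_ampPrimeFamilyTwo_total_pb hLR hP hL hS hc hδ htot htw hE hp
  exact ⟨c₀, hc₀, D₀, fun D _ χ hD hprim hquad => h D χ hD hprim hquad⟩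

end Literature.NumberTheory.LFunctions.CentralValueFamilyHalfEdge

end
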